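import Summits.QuantumFields.YangMills.Theorems.BalabanUVNodesN06LettersSAtPinsPU
import Summits.QuantumFields.YangMills.Theorems.BalabanUVNodesN06L3131HLegAtPinsPhysPU
import Literature.MathematicalPhysics.QuantumFieldTheory.Balaban1983to89.B9Thm313WholeDelta2LettersAtStatePrint
import Literature.MathematicalPhysics.QuantumFieldTheory.Balaban1983to89.B9Thm312WholeStepRegular
import Literature.MathematicalPhysics.QuantumFieldTheory.Balaban1983to89.B9MultiscaleSmoothPartitionYNear

/-!
# CASCADE-K «K3-D» (director-ym №383) — THE SITE-TRANSPORTER-PARAMETRIC RE-PRESS of `N06LettersSAtPinsPU`: `hLettersS_of_pinsP44_geo9Y_par` = the landed `hLettersS_of_pinsP44_geo9Y` VERBATIM with the record's symmetric site transporter `parSymY x.toKIdx` replaced by a PARAMETER `parT : ∀ i, SiteParY _ i` (every `GpY ∕ GpPhysY ∕ TpicoK ∕ T2coK ∕ RcoK …` letter read at `parT x.toKIdx`; proofs verbatim — the callees are transporter-generic or their landed `_par` twins are called).  At `parT := fun i => parSymY i` these ARE the originals; at the knit transporter they serve the knit certificate's Sect.-D network «KD» (dag-n06-d g25∕g26, HOME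 `K3D-CENSUS-g25.md`).  Seat `pub-ymgap-dag-n06-d` (g26), 2026-08-30.  The original module text below applies word for word otherwise.
#

# N06 [B9] — THE ROWS-20∕21 LETTERS `LettersS3131` AT THE REGULAR STATE CLASS 𝔖₂ = (Lʲη)⁻¹·(P1′), AT THE PINS (R-generic, U-variant)

T. Bałaban, *Propagators for lattice gauge theories in a background field*, Commun. Math. Phys. **99** (1985) 389–434
[`Balaban1985BackgroundPropagators`, "B9"], (3.128)–(3.131) p. 421–422, (3.135)–(3.138) pp. 422–423, (3.43)–(3.44) p. 398; [4] = T. Bałaban,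
*Propagators and renormalization transformations for lattice gauge theories. II*, Commun. Math. Phys. **96** (1984) 223–250
[`Balaban1984PropagatorsII`], (2.51)–(2.54), (2.60)–(2.61) pp. 232–234.

LOCATED-U8 (dag-n06-l, director №272 (5)): the certificate of record displays the Δ⁽²⁾ letters `hta₂ ∕ htb₂` on the RAW class
`𝔠⁽²⁾ → 𝔠⁽⁰⁾ ∕ 𝔠_W⁽¹⁾` — beyond print.  Print applies T = Δ′_π + Δ⁽²⁾_π only to a REGULAR state (a G₀-output with its Hölder sizes).  THIS FILE
knits, at the certificate's pins and member-uniformly, the four letters of `B9Thm312WholeStepRegular.LettersS3131` with the SOURCE the regular state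
class `𝔖₂(x,U) := weightNorm (bXH x U) (rwt (geo9Y x) (−1)) _` ((P1′) class `bHZKPG (U(Γ)) wX` carried to dimension 2) and the W-target the (P2′)
class `bH13 x U`:
* `ta`, `tbH` — the certificate's derived raw letters `hta : 𝔠⁽²⁾ → 𝔠⁽⁰⁾`, `htbH : 𝔠⁽²⁾ → bH13` raised to the state source
  (`B9Thm313WholeDelta2LettersAtStatePrint.hasMaj_state_of_raw_two`);
* `ta₂` — from the displayed `h44G` ((3.44) for G′ out of the (P1′) class), `hD2sup` ((3.137)), `h31`, `h49` (`ta2S_pins_print_of_h44G`);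
* `tb₂H` — from the same and ONE displayed (3.43) member `h43Gp` of G′∇\*_U into `bH13` (`tb₂HS_pins_print_of_h43`);
all four weakened to ONE member-uniform constant `tS·(Mα₀)` and ONE rate `δS` (`htS₁ htS₂ htS₃` are the closed numeric comparisons the
certificate discharges by `le_max_…`).  NO raw-class Δ⁽²⁾ letter is consumed: the inputs are `hta htbH h44G h43Gp hD2sup h31 h49` and the
(P1′)∕(P2′) pin axioms — all already displayed or derived in the certificate of record.

HONEST LABEL: helper toward the U8 re-leaf (row 20 of bundle F7) over dag-n06-l's S-leaf `thm312Printed_completePairMBZS(_rates)`; every member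
enters as a HYPOTHESIS of printed species; count-neutral; N06 NOT discharged; K1⁹ NOT closed; nothing continuum ∕ OS ∕ mass gap ∕ Clay.
Cell `pub-ymgap` (HUMAN RULING D-0062), Track A node N06 [B9], seat `pub-ymgap-dag-n06-d` (g17), 2026-08-29.  NEW file; nothing landed is modified.
-/

noncomputable section

namespace Summit.QuantumFields.YangMills.BalabanUVNodes.N06LettersSAtPinsPUPar

open Summit.QuantumFields.YangMills.BalabanUVNodes.N06LettersSAtPinsPU (ta2_expr_le tb2_expr_le ta2_expr_nonneg)

open Literature.MathematicalPhysics.QuantumFieldTheory.Balaban1983to89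
open Literature.MathematicalPhysics.QuantumFieldTheory.Balaban1983to89.Node00 (FBondY IBondY SiteY CfgY SiteParY SiteOpY parSymY GpY GpPhysY BondOpY toKT)
open Literature.MathematicalPhysics.QuantumFieldTheory.Balaban1983to89.Node00.OpsYSectDCoords (DvcoKH DvscoKH TpicoK T2coK cR39_trBasis_pos)
open B9Thm39ReadingCoords (cR39)
open B9Thm34Ext (toB6)
open B11SectG (HasMaj BlockNorm RowSum)
open B9Thm312Whole (cNorm GeoOK)
open B9Thm312WholeClasses (cNormR rwt rwt_nonneg)
open B9RWSums343to347Whole (Facts347)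
open B9CoReadingCoords (XBK blkBK)
open B9CoReadingCoordsS (XSK sIK blkSK GcoS)
open B9CoReadingCoordsH (XHK)
open B9CoReadingCoordsTranspose (TrIdx trBasis)
open B9PinMembersKLevelV1 (MemberY geo9Y)
open B9BackgroundsKLevelV1R (RegFamY bg9YR MemOfFam)
open B9GeoLemma21KLevelV1 (geo9Y_len_pos geo9Y_dist_triangle geo9Y_dist_comm rowSum261_geo9Y)
open B9GeoNormsKLevelV1 (geo9K geo9K_dist_nonneg)
open B7Prop2SpecialUnitary (specialUnitaryUnits)
open B9PerturbationMajorantAlgebra (Proj349Maj Thm31GpMaj hasMaj_weaken)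
open B9PerturbationMajorantsAtLetters (PcoK)
open B9MultiscaleSmoothPartitionYNear (rNear dist_sIK_le_of_nearY)
open B9SmoothHolderClassP (bHZKP bHZKPG bHZPG)
open B9GradViaDivLettersTransported (taxiB taxiS)
open B9PerturbationSplitAtLetters (TaLcoK TbLcoKH Ta2LcoK Tb2LcoKH tpi_t2_splitL_of_pins)
open B9PerturbationL2Delta2 (D2coK)
open B9SmoothHolderClassPProducers (CTel CTel_nonneg CTel_mono CTel_mul)
open B9SmoothHolderClassTClosure (abs_cf_eq_nKT)
open B9RWSums347DefiniteFaces (geo9Y_scalars exp261 facts347_exp261_geo9Y)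
open B9RowSum261DefiniteFaces (rowConst261 rowConst261_nonneg rowConst261_spec_of_rowSum261)
open B9SectDSup (weightNorm)
open B6RandomWalk (HasMajorant)
open B9Thm312WholeStepRegular (LettersS3131)
open B9Thm313WholeDelta2LettersAtStatePrint (ta2S_pins_print_of_h44G tb₂HS_pins_print_of_h43 hasMaj_state_of_raw_two)
open Summit.QuantumFields.YangMills.BalabanUVNodes.N06HolderPinsGradedAtRecord (links_le_one)
open B6Prop22KLevelTorusCensusEta (nKT)
open B6GlobalChartV1 (PV blkV1) open B6Ineq2142KLevelV1 (β lvl) open B6Geom246MultiLevelTorus (geomT)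
open scoped Matrix.Norms.L2Operator

variable {N : ℕ} {d ℓ : ℕ} {hd : 1 ≤ d + 1} {hL : Odd (ℓ + 1) ∧ 1 < ℓ + 1} {b₀ b₁ : ℝ} {Mstar : ℕ}

/-- ★★★ **THE ROWS-20∕21 LETTERS AT THE REGULAR STATE CLASS, AT THE PINS** (U8 step 1): member-uniformly in `x`, for `M ≥ M_T`, `Mα₀ ≤ a₀`,
U ∈ (3.35)–(3.36): `LettersS3131 (𝔬12 x) T_a T_a₂ T_b T_b₂ 1 (H x) _ 𝔖₂(x,U) (bH13 x U) (t_S·(Mα₀)) δ_S U` with 𝔖₂(x,U) = `weightNorm (bXH x U) (rwt (geo9Y x) (−1)) _`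
((P1′) class to dimension 2): the splits at the pinned letters (`tpi_t2_splitL_of_pins`), `ta ∕ tbH` = the raw letters `hta ∕ htbH` on the state source
(`hasMaj_state_of_raw_two`), `ta₂` from `h44G hD2 h31 h49` (`ta2S_pins_print_of_h44G`), `tb₂H` from the same and `h43` (`tb₂HS_pins_print_of_h43`), all at
the common constant `t_S·(Mα₀)` (`htS₁ htS₂ htS₃`) and rate `δ_S` (`δ_S + 3σ + 3τ ≤ r ≤ min(δ₀, δ_P, δ₂, δ₄₄ − τ)`, `δ_S + σ ≤ min(δ₄₃, δ_T)`).
[cite: Balaban1985BackgroundPropagators, (3.128)–(3.131) pp.421–422, (3.135)–(3.138) pp.422–423, (3.43)–(3.44) p.398, (3.49) p.399;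
Balaban1984PropagatorsII, (2.51)–(2.54) pp.232–233, Lemma 2.1 (2.60)–(2.61) p.234] -/
theorem hLettersS_of_pinsP44_geo9Y_par
    (parT : ∀ i : B6KLevelCensusIndexV1.KIdx d ℓ hd hL b₀ b₁, Node00.SiteParY (Matrix (Fin N) (Fin N) ℂ) i) [NeZero N] [∀ x : MemberY d ℓ hd hL b₀ b₁ Mstar, Fintype (geo9Y x).Site]
    {R₁ R₂ : RegFamY d ℓ hd hL b₀ b₁ Mstar (Matrix (Fin N) (Fin N) ℂ)} (H : MemberY d ℓ hd hL b₀ b₁ Mstar → Prop)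
    (bI : ∀ x : MemberY d ℓ hd hL b₀ b₁ Mstar, FBondY x.toKIdx → IBondY x.toKIdx)
    (hlev : ∀ (x : MemberY d ℓ hd hL b₀ b₁ Mstar) (f : FBondY x.toKIdx), lvl x.hN x.D x.hk (bI x f) = (blkV1 x.hN x.D f).1.1)
    (hβ1 : ∀ (x : MemberY d ℓ hd hL b₀ b₁ Mstar) (f : FBondY x.toKIdx), (geomT x.D).dist (β x.hN x.D x.hk (bI x f)) (blkV1 x.hN x.D f) ≤ 1)
    (hbI0 : ∀ (x : MemberY d ℓ hd hL b₀ b₁ Mstar) (f : FBondY x.toKIdx), bI x f = bI x ⟨f.src, 0⟩)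
    (hGR : MemOfFam (specialUnitaryUnits (Fin N)) R₁) (c : ℝ) {M₀ a₀ : ℝ} (hM₀ : 0 ≤ M₀) {σ τ : ℝ} (hσ : 0 < σ) (hτ : 0 < τ)
    (w13 : ℝ → ℝ) (hw13₀ : ∀ s, 0 ≤ w13 s) (hw13₁ : ∀ s, w13 s ≤ 1)
    (bH13 : ∀ x : MemberY d ℓ hd hL b₀ b₁ Mstar, (bg9YR (Matrix (Fin N) (Fin N) ℂ) (specialUnitaryUnits (Fin N)) R₁ R₂ x).Cfg → BlockNorm (toB6 (geo9Y x) 1 (H x)) (XSK (TrIdx N) x.toKIdx → ℝ))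
    (hbH13 : ∀ (x : MemberY d ℓ hd hL b₀ b₁ Mstar) (U : (bg9YR (Matrix (Fin N) (Fin N) ℂ) (specialUnitaryUnits (Fin N)) R₁ R₂ x).Cfg), bH13 x U =
      letI : Fintype (geo9K x.toKIdx).Site := (inferInstance : Fintype (geo9Y x).Site);
      bHZPG (κ := TrIdx N) x.toKIdx (trBasis N) (taxiS x.toKIdx (bg9YR (Matrix (Fin N) (Fin N) ℂ) (specialUnitaryUnits (Fin N)) R₁ R₂ x) (fun U => U) U) (R := (1 : ℝ)) (H := H x) w13 hw13₀ hw13₁)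
    (wX : ℝ → ℝ) (hwX₀ : ∀ s, 0 ≤ wX s) (hwX₁ : ∀ s, wX s ≤ 1)
    (bXH : ∀ x : MemberY d ℓ hd hL b₀ b₁ Mstar, (bg9YR (Matrix (Fin N) (Fin N) ℂ) (specialUnitaryUnits (Fin N)) R₁ R₂ x).Cfg → BlockNorm (toB6 (geo9Y x) 1 (H x)) (XBK (TrIdx N) x.toKIdx → ℝ))
    (hbXH : ∀ (x : MemberY d ℓ hd hL b₀ b₁ Mstar) (U : (bg9YR (Matrix (Fin N) (Fin N) ℂ) (specialUnitaryUnits (Fin N)) R₁ R₂ x).Cfg), bXH x U =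
      letI : Fintype (geo9K x.toKIdx).Site := (inferInstance : Fintype (geo9Y x).Site);
      bHZKPG (κ := TrIdx N) x.toKIdx (trBasis N) (taxiB x.toKIdx (bg9YR (Matrix (Fin N) (Fin N) ℂ) (specialUnitaryUnits (Fin N)) R₁ R₂ x) (fun U => U) U) (R := (1 : ℝ)) (H := H x) wX hwX₀ hwX₁)
    {s44 : ℝ} (hs440 : 0 < s44) (hs441 : s44 < 1) (hwX44 : 0 < wX s44)
    (𝔬12 : ∀ x : MemberY d ℓ hd hL b₀ b₁ Mstar, B9Thm312Whole.Ops (geo9Y x) (bg9YR (Matrix (Fin N) (Fin N) ℂ) (specialUnitaryUnits (Fin N)) R₁ R₂ x) (XBK (TrIdx N) x.toKIdx) (XBK (TrIdx N) x.toKIdx) (XHK (TrIdx N) x.toKIdx) (XSK (TrIdx N) x.toKIdx))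
    (hblk12 : ∀ x : MemberY d ℓ hd hL b₀ b₁ Mstar, (𝔬12 x).blk = blkBK x.toKIdx (bI x))
    (Δ2 : ∀ x : MemberY d ℓ hd hL b₀ b₁ Mstar, BondOpY (Matrix (Fin N) (Fin N) ℂ) x.toKIdx)
    (hTpico12 : ∀ (x : MemberY d ℓ hd hL b₀ b₁ Mstar) (U : (bg9YR (Matrix (Fin N) (Fin N) ℂ) (specialUnitaryUnits (Fin N)) R₁ R₂ x).Cfg), (𝔬12 x).Tpi U = TpicoK x.toKIdx (trBasis N) (bg9YR (Matrix (Fin N) (Fin N) ℂ) (specialUnitaryUnits (Fin N)) R₁ R₂ x) (fun U => U) (parT x.toKIdx) (GpPhysY x.toKIdx (parT x.toKIdx)) U)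
    (hT2co12 : ∀ (x : MemberY d ℓ hd hL b₀ b₁ Mstar) (U : (bg9YR (Matrix (Fin N) (Fin N) ℂ) (specialUnitaryUnits (Fin N)) R₁ R₂ x).Cfg) , (𝔬12 x).T2 U = T2coK x.toKIdx (trBasis N) (bg9YR (Matrix (Fin N) (Fin N) ℂ) (specialUnitaryUnits (Fin N)) R₁ R₂ x) (fun U => U) (parT x.toKIdx) (GpPhysY x.toKIdx (parT x.toKIdx)) (Δ2 x) U)
    (hDvco12 : ∀ (x : MemberY d ℓ hd hL b₀ b₁ Mstar) (U : (bg9YR (Matrix (Fin N) (Fin N) ℂ) (specialUnitaryUnits (Fin N)) R₁ R₂ x).Cfg), (𝔬12 x).Dv U = DvcoKH x.toKIdx (trBasis N) (bg9YR (Matrix (Fin N) (Fin N) ℂ) (specialUnitaryUnits (Fin N)) R₁ R₂ x) (fun U => U) U)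
    {B₀ δ₀ CP δP θ₂ δ₂ B44 δ44 B43 δ43 tA δT r δS : ℝ} (hB₀ : 0 ≤ B₀) (hCP : 0 ≤ CP) (hθ₂ : 0 ≤ θ₂) (hB44 : 0 ≤ B44) (hB43 : 0 ≤ B43) (htA : 0 ≤ tA)
    (hr : 0 ≤ r) (hr₀ : r ≤ δ₀) (hrP : r ≤ δP) (hr₂ : r ≤ δ₂) (hr44 : r + τ ≤ δ44) (hδS : 0 ≤ δS) (hbud : δS + 3 * σ + 3 * τ ≤ r)
    (hbud43 : δS + σ ≤ δ43) (hbudT : δS + σ ≤ δT) {tS : ℝ}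
    (htS₁ : tA * ((wX s44)⁻¹ * ((((ℓ + 1 : ℕ) : ℝ)) * Real.exp ((δS + τ) * (rNear d ℓ + 1))) * (((ℓ + 1 : ℕ) : ℝ))) * rowConst261 (@geo9Y d ℓ hd hL b₀ b₁ Mstar) σ ≤ tS)
    (htS₂ : θ₂ * ((((ℓ + 1 : ℕ) : ℝ)) ^ 2 * (((wX s44)⁻¹ * ((((ℓ + 1 : ℕ) : ℝ)) * Real.exp ((r + τ) * (rNear d ℓ + 1))) * (((ℓ + 1 : ℕ) : ℝ))) + (cR39 (trBasis N))⁻¹ * ((wX s44)⁻¹ * B44 * (((ℓ + 1 : ℕ) : ℝ))) + (cR39 (trBasis N))⁻¹ * (B₀ * (((ℓ + 1 : ℕ) : ℝ)) * (CP * (((ℓ + 1 : ℕ) : ℝ)) ^ 2) * (rowConst261 (@geo9Y d ℓ hd hL b₀ b₁ Mstar) σ) * ((wX s44)⁻¹ * ((((ℓ + 1 : ℕ) : ℝ)) * Real.exp ((r + τ) * (rNear d ℓ + 1))) * (((ℓ + 1 : ℕ) : ℝ))) * (rowConst261 (@geo9Y d ℓ hd hL b₀ b₁ Mstar) σ)))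 * (rowConst261 (@geo9Y d ℓ hd hL b₀ b₁ Mstar) σ)) ≤ tS)
    (htS₃ : B43 * ((cR39 (trBasis N))⁻¹ * (θ₂ * ((((ℓ + 1 : ℕ) : ℝ)) ^ 2 * (((wX s44)⁻¹ * ((((ℓ + 1 : ℕ) : ℝ)) * Real.exp ((r + τ) * (rNear d ℓ + 1))) * (((ℓ + 1 : ℕ) : ℝ))) + (cR39 (trBasis N))⁻¹ * ((wX s44)⁻¹ * B44 * (((ℓ + 1 : ℕ) : ℝ))) + (cR39 (trBasis N))⁻¹ * (B₀ * (((ℓ + 1 : ℕ) : ℝ)) * (CP * (((ℓ + 1 : ℕ) : ℝ)) ^ 2) * (rowConst261 (@geo9Y d ℓ hd hL b₀ b₁ Mstar) σ) * ((wX s44)⁻¹ * ((((ℓ + 1 : ℕ) : ℝ)) * Real.exp ((r + τ) * (rNear d ℓ + 1))) * (((ℓ + 1 : ℕ) : ℝ))) * (rowConst261 (@geo9Y d ℓ hd hL b₀ b₁ Mstar) σ))) * (rowConst261 (@geo9Y d ℓ hd hL b₀ b₁ Mstar) σ)))) * rowConst261 (@geo9Y d ℓ hd hL b₀ b₁ Mstar)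 σ +
      CTel d ℓ (trBasis N) δS
        (CP * (((ℓ + 1 : ℕ) : ℝ)) * (B₀ * ((cR39 (trBasis N))⁻¹ * (θ₂ * ((((ℓ + 1 : ℕ) : ℝ)) ^ 2 * (((wX s44)⁻¹ * ((((ℓ + 1 : ℕ) : ℝ)) * Real.exp ((r + τ) * (rNear d ℓ + 1))) * (((ℓ + 1 : ℕ) : ℝ))) + (cR39 (trBasis N))⁻¹ * ((wX s44)⁻¹ * B44 * (((ℓ + 1 : ℕ) : ℝ))) + (cR39 (trBasis N))⁻¹ * (B₀ * (((ℓ + 1 : ℕ) : ℝ)) * (CP * (((ℓ + 1 : ℕ) : ℝ)) ^ 2) * (rowConst261 (@geo9Y d ℓ hd hL b₀ b₁ Mstar) σ) * ((wX s44)⁻¹ * ((((ℓ + 1 : ℕ) : ℝ)) * Real.exp ((r + τ) * (rNear d ℓ + 1))) * (((ℓ + 1 : ℕ) : ℝ))) * (rowConst261 (@geo9Y d ℓ hd hL b₀ b₁ Mstar) σ))) * (rowConst261 (@geo9Y d ℓ hd hL b₀ b₁ Mstar) σ)))) * rowConst261 (@geo9Y d ℓ hd hL b₀ b₁ Mstar)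 σ) * rowConst261 (@geo9Y d ℓ hd hL b₀ b₁ Mstar) σ)
        (CP * (((ℓ + 1 : ℕ) : ℝ)) * (B₀ * ((cR39 (trBasis N))⁻¹ * (θ₂ * ((((ℓ + 1 : ℕ) : ℝ)) ^ 2 * (((wX s44)⁻¹ * ((((ℓ + 1 : ℕ) : ℝ)) * Real.exp ((r + τ) * (rNear d ℓ + 1))) * (((ℓ + 1 : ℕ) : ℝ))) + (cR39 (trBasis N))⁻¹ * ((wX s44)⁻¹ * B44 * (((ℓ + 1 : ℕ) : ℝ))) + (cR39 (trBasis N))⁻¹ * (B₀ * (((ℓ + 1 : ℕ) : ℝ)) * (CP * (((ℓ + 1 : ℕ) : ℝ)) ^ 2) * (rowConst261 (@geo9Y d ℓ hd hL b₀ b₁ Mstar) σ) * ((wX s44)⁻¹ * ((((ℓ + 1 : ℕ) : ℝ)) * Real.exp ((r + τ) * (rNear d ℓ + 1))) * (((ℓ + 1 : ℕ) : ℝ))) * (rowConst261 (@geo9Y d ℓ hd hL b₀ b₁ Mstar) σ))) * (rowConst261 (@geo9Y d ℓ hd hL b₀ b₁ Mstar) σ)))) * rowConst261 (@geo9Y d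 ℓ hd hL b₀ b₁ Mstar) σ) * rowConst261 (@geo9Y d ℓ hd hL b₀ b₁ Mstar) σ) ≤ tS)
    {Gp : ∀ x : MemberY d ℓ hd hL b₀ b₁ Mstar, SiteOpY (Matrix (Fin N) (Fin N) ℂ) x.toKIdx} (hGp : ∀ x : MemberY d ℓ hd hL b₀ b₁ Mstar, Gp x = GpY x.toKIdx (parT x.toKIdx))
    {parS : ∀ x : MemberY d ℓ hd hL b₀ b₁ Mstar, SiteParY (Matrix (Fin N) (Fin N) ℂ) x.toKIdx} (hparS : ∀ x : MemberY d ℓ hd hL b₀ b₁ Mstar, parS x = parT x.toKIdx)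
    (h31 : ∀ x : MemberY d ℓ hd hL b₀ b₁ Mstar, M₀ ≤ (geo9Y x).M → ∀ α₀ : ℝ, 0 < α₀ → (geo9Y x).M * α₀ ≤ a₀ → ∀ U : (bg9YR (Matrix (Fin N) (Fin N) ℂ) (specialUnitaryUnits (Fin N)) R₁ R₂ x).Cfg, (bg9YR (Matrix (Fin N) (Fin N) ℂ) (specialUnitaryUnits (Fin N)) R₁ R₂ x).Reg335 c α₀ U →
      Thm31GpMaj (g := geo9Y x) (blkSK x.toKIdx (sIK x.toKIdx (bI x))) (blkBK x.toKIdx (bI x))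
        (GcoS x.toKIdx (trBasis N) (bg9YR (Matrix (Fin N) (Fin N) ℂ) (specialUnitaryUnits (Fin N)) R₁ R₂ x) (fun U => U) (Gp x) U)
        (DvcoKH x.toKIdx (trBasis N) (bg9YR (Matrix (Fin N) (Fin N) ℂ) (specialUnitaryUnits (Fin N)) R₁ R₂ x) (fun U => U) U) (DvscoKH x.toKIdx (trBasis N) (bg9YR (Matrix (Fin N) (Fin N) ℂ) (specialUnitaryUnits (Fin N)) R₁ R₂ x) (fun U => U) U) 1 (H x) B₀ δ₀)
    (h49 : ∀ x : MemberY d ℓ hd hL b₀ b₁ Mstar, M₀ ≤ (geo9Y x).M → ∀ α₀ : ℝ, 0 < α₀ → (geo9Y x).M * α₀ ≤ a₀ → ∀ U : (bg9YR (Matrix (Fin N) (Fin N) ℂ) (specialUnitaryUnits (Fin N)) R₁ R₂ x).Cfg, (bg9YR (Matrix (Fin N) (Fin N) ℂ) (specialUnitaryUnits (Fin N)) R₁ R₂ x).Reg335 c α₀ U →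
      Proj349Maj (g := geo9Y x) (blkSK x.toKIdx (sIK x.toKIdx (bI x))) (blkBK x.toKIdx (bI x))
        (PcoK x.toKIdx (trBasis N) (bg9YR (Matrix (Fin N) (Fin N) ℂ) (specialUnitaryUnits (Fin N)) R₁ R₂ x) (fun U => U) (parS x) (Gp x) U)
        (DvcoKH x.toKIdx (trBasis N) (bg9YR (Matrix (Fin N) (Fin N) ℂ) (specialUnitaryUnits (Fin N)) R₁ R₂ x) (fun U => U) U) (DvscoKH x.toKIdx (trBasis N) (bg9YR (Matrix (Fin N) (Fin N) ℂ) (specialUnitaryUnits (Fin N)) R₁ R₂ x) (fun U => U) U) 1 (H x) CP δP)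
    (h43 : ∀ x : MemberY d ℓ hd hL b₀ b₁ Mstar, letI : Fintype (geo9K x.toKIdx).Site := (inferInstance : Fintype (geo9Y x).Site); M₀ ≤ (geo9Y x).M → ∀ α₀ : ℝ, 0 < α₀ → (geo9Y x).M * α₀ ≤ a₀ → ∀ U : (bg9YR (Matrix (Fin N) (Fin N) ℂ) (specialUnitaryUnits (Fin N)) R₁ R₂ x).Cfg, (bg9YR (Matrix (Fin N) (Fin N) ℂ) (specialUnitaryUnits (Fin N)) R₁ R₂ x).Reg335 c α₀ U →
      (bg9YR (Matrix (Fin N) (Fin N) ℂ) (specialUnitaryUnits (Fin N)) R₁ R₂ x).Reg336 c α₀ U →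
        HasMaj (cNorm 1 (H x) (𝔬12 x).blk (fun y => (geo9Y_len_pos x y).le) 0) (bH13 x U)
          (GcoS x.toKIdx (trBasis N) (bg9YR (Matrix (Fin N) (Fin N) ℂ) (specialUnitaryUnits (Fin N)) R₁ R₂ x) (fun U => U) (GpY x.toKIdx (parT x.toKIdx)) U ∘ₗ DvscoKH x.toKIdx (trBasis N) (bg9YR (Matrix (Fin N) (Fin N) ℂ) (specialUnitaryUnits (Fin N)) R₁ R₂ x) (fun U => U) U)
          (fun a a' => B43 * Real.exp (-(δ43 * (geo9Y x).dist a a'))))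
    (h44G : ∀ x : MemberY d ℓ hd hL b₀ b₁ Mstar, letI : Fintype (geo9K x.toKIdx).Site := (inferInstance : Fintype (geo9Y x).Site); M₀ ≤ (geo9Y x).M → ∀ α₀ : ℝ, 0 < α₀ → (geo9Y x).M * α₀ ≤ a₀ → ∀ U : (bg9YR (Matrix (Fin N) (Fin N) ℂ) (specialUnitaryUnits (Fin N)) R₁ R₂ x).Cfg, (bg9YR (Matrix (Fin N) (Fin N) ℂ) (specialUnitaryUnits (Fin N)) R₁ R₂ x).Reg335 c α₀ U → (bg9YR (Matrix (Fin N) (Fin N) ℂ) (specialUnitaryUnits (Fin N)) R₁ R₂ x).Reg336 c α₀ U →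
      HasMaj (bHZKP (κ := TrIdx N) x.toKIdx (trBasis N) (taxiB x.toKIdx (bg9YR (Matrix (Fin N) (Fin N) ℂ) (specialUnitaryUnits (Fin N)) R₁ R₂ x) (fun U => U) U) (R := (1 : ℝ)) (H := H x) hs440.le hs441.le) (cNorm 1 (H x) (𝔬12 x).blk (fun y => (geo9Y_len_pos x y).le) 1)
        ((𝔬12 x).Dv U ∘ₗ GcoS x.toKIdx (trBasis N) (bg9YR (Matrix (Fin N) (Fin N) ℂ) (specialUnitaryUnits (Fin N)) R₁ R₂ x) (fun U => U) (GpY x.toKIdx (parT x.toKIdx)) U ∘ₗ (𝔬12 x).Dvstar U) (fun a b => B44 * Real.exp (-(δ44 * (geo9Y x).dist a b))))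
    (hDvsco12 : ∀ (x : MemberY d ℓ hd hL b₀ b₁ Mstar) (U : (bg9YR (Matrix (Fin N) (Fin N) ℂ) (specialUnitaryUnits (Fin N)) R₁ R₂ x).Cfg), (𝔬12 x).Dvstar U = DvscoKH x.toKIdx (trBasis N) (bg9YR (Matrix (Fin N) (Fin N) ℂ) (specialUnitaryUnits (Fin N)) R₁ R₂ x) (fun U => U) U)
    (hD2 : ∀ x : MemberY d ℓ hd hL b₀ b₁ Mstar, M₀ ≤ (geo9Y x).M → ∀ α₀ : ℝ, 0 < α₀ → (geo9Y x).M * α₀ ≤ a₀ → ∀ U : (bg9YR (Matrix (Fin N) (Fin N) ℂ) (specialUnitaryUnits (Fin N)) R₁ R₂ x).Cfg, (bg9YR (Matrix (Fin N) (Fin N) ℂ) (specialUnitaryUnits (Fin N)) R₁ R₂ x).Reg335 c α₀ U →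
      (bg9YR (Matrix (Fin N) (Fin N) ℂ) (specialUnitaryUnits (Fin N)) R₁ R₂ x).Reg336 c α₀ U → HasMajorant (g := toB6 (geo9Y x) 1 (H x)) (𝔬12 x).blk (D2coK x.toKIdx (trBasis N) (bg9YR (Matrix (Fin N) (Fin N) ℂ) (specialUnitaryUnits (Fin N)) R₁ R₂ x) (fun U => U) (Δ2 x) U) (fun (a b : (geo9Y x).Site) => θ₂ * ((geo9Y x).M * α₀) * ((geo9Y x).len a ^ 2)⁻¹ * Real.exp (-(δ₂ * (geo9Y x).dist a b))))
    (hta : ∀ x : MemberY d ℓ hd hL b₀ b₁ Mstar, M₀ ≤ (geo9Y x).M → ∀ α₀ : ℝ, 0 < α₀ → (geo9Y x).M * α₀ ≤ a₀ → ∀ U : (bg9YR (Matrix (Fin N) (Fin N) ℂ) (specialUnitaryUnits (Fin N)) R₁ R₂ x).Cfg, (bg9YR (Matrix (Fin N) (Fin N) ℂ) (specialUnitaryUnits (Fin N)) R₁ R₂ x).Reg335 c α₀ U →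
      (bg9YR (Matrix (Fin N) (Fin N) ℂ) (specialUnitaryUnits (Fin N)) R₁ R₂ x).Reg336 c α₀ U → HasMaj (cNorm 1 (H x) (𝔬12 x).blk (fun y => (geo9Y_len_pos x y).le) 2) (cNorm 1 (H x) (𝔬12 x).blk (fun y => (geo9Y_len_pos x y).le) 0) (TaLcoK x.toKIdx (trBasis N) (bg9YR (Matrix (Fin N) (Fin N) ℂ) (specialUnitaryUnits (Fin N)) R₁ R₂ x) (fun U => U) (parT x.toKIdx) (GpPhysY x.toKIdx (parT x.toKIdx)) U) (fun a a' => tA * ((geo9Y x).M * α₀) * Real.exp (-(δT * (geo9Y x).dist a a'))))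
    (htbH : ∀ x : MemberY d ℓ hd hL b₀ b₁ Mstar, M₀ ≤ (geo9Y x).M → ∀ α₀ : ℝ, 0 < α₀ → (geo9Y x).M * α₀ ≤ a₀ → ∀ U : (bg9YR (Matrix (Fin N) (Fin N) ℂ) (specialUnitaryUnits (Fin N)) R₁ R₂ x).Cfg, (bg9YR (Matrix (Fin N) (Fin N) ℂ) (specialUnitaryUnits (Fin N)) R₁ R₂ x).Reg335 c α₀ U →
      (bg9YR (Matrix (Fin N) (Fin N) ℂ) (specialUnitaryUnits (Fin N)) R₁ R₂ x).Reg336 c α₀ U → HasMaj (cNorm 1 (H x) (𝔬12 x).blk (fun y => (geo9Y_len_pos x y).le) 2) (bH13 x U) (TbLcoKH x.toKIdx (trBasis N) (bg9YR (Matrix (Fin N) (Fin N) ℂ) (specialUnitaryUnits (Fin N)) R₁ R₂ x) (fun U => U) (parT x.toKIdx) (GpPhysY x.toKIdx (parT x.toKIdx)) U) (fun a a' => tA * ((geo9Y x).M * α₀) * Real.exp (-(δT * (geo9Y x).dist a a')))) :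
    ∃ MT : ℝ, ∀ x : MemberY d ℓ hd hL b₀ b₁ Mstar, MT ≤ (geo9Y x).M → ∀ α₀ : ℝ, 0 < α₀ → (geo9Y x).M * α₀ ≤ a₀ → ∀ U : (bg9YR (Matrix (Fin N) (Fin N) ℂ) (specialUnitaryUnits (Fin N)) R₁ R₂ x).Cfg, (bg9YR (Matrix (Fin N) (Fin N) ℂ) (specialUnitaryUnits (Fin N)) R₁ R₂ x).Reg335 c α₀ U →
      (bg9YR (Matrix (Fin N) (Fin N) ℂ) (specialUnitaryUnits (Fin N)) R₁ R₂ x).Reg336 c α₀ U →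
        LettersS3131 (𝔬12 x) (TaLcoK x.toKIdx (trBasis N) (bg9YR (Matrix (Fin N) (Fin N) ℂ) (specialUnitaryUnits (Fin N)) R₁ R₂ x) (fun U => U) (parT x.toKIdx) (GpPhysY x.toKIdx (parT x.toKIdx)))
          (Ta2LcoK x.toKIdx (trBasis N) (bg9YR (Matrix (Fin N) (Fin N) ℂ) (specialUnitaryUnits (Fin N)) R₁ R₂ x) (fun U => U) (parT x.toKIdx) (GpPhysY x.toKIdx (parT x.toKIdx)) (Δ2 x))
          (TbLcoKH x.toKIdx (trBasis N) (bg9YR (Matrix (Fin N) (Fin N) ℂ) (specialUnitaryUnits (Fin N)) R₁ R₂ x) (fun U => U) (parT x.toKIdx) (GpPhysY x.toKIdx (parT x.toKIdx)))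
          (Tb2LcoKH x.toKIdx (trBasis N) (bg9YR (Matrix (Fin N) (Fin N) ℂ) (specialUnitaryUnits (Fin N)) R₁ R₂ x) (fun U => U) (parT x.toKIdx) (GpPhysY x.toKIdx (parT x.toKIdx)) (Δ2 x)) 1 (H x) (fun y => (geo9Y_len_pos x y).le)
          (weightNorm (bXH x U) (rwt (geo9Y x) (-1)) (rwt_nonneg (fun y => (geo9Y_len_pos x y).le) (-1))) (bH13 x U) (tS * ((geo9Y x).M * α₀)) δS U := by
  obtain ⟨Mg, hFa⟩ := facts347_exp261_geo9Y (d := d) (ℓ := ℓ) (hd := hd) (hL := hL) (b₀ := b₀) (b₁ := b₁) (Mstar := Mstar) H (α := 1 / 2) (δ := 2 * τ)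
    (by norm_num) (by norm_num) (by linarith)
  obtain ⟨ML, hrow⟩ := rowConst261_spec_of_rowSum261 (rowSum261_geo9Y (d := d) (ℓ := ℓ) (hd := hd) (hL := hL) (b₀ := b₀) (b₁ := b₁) (Mstar := Mstar)) hσ
  have hc0 : (0 : ℝ) ≤ rowConst261 (@geo9Y d ℓ hd hL b₀ b₁ Mstar) σ := rowConst261_nonneg _ _
  have hτ' : (0 : ℝ) ≤ 1 / 2 * (2 * τ) := by linarith
  have hτe : (1 : ℝ) / 2 * (2 * τ) = τ := by ring
  refine ⟨max M₀ (max Mg ML), fun x hM α₀ hα ha U hU hU' => ?_⟩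
  letI : Fintype (geo9K x.toKIdx).Site := (inferInstance : Fintype (geo9Y x).Site)
  have hM0 : M₀ ≤ (geo9Y x).M := (le_max_left _ _).trans hM
  have hrowx : RowSum (toB6 (geo9Y x) 1 (H x)) σ (rowConst261 (@geo9Y d ℓ hd hL b₀ b₁ Mstar) σ) := fun y => hrow x (((le_max_right _ _).trans (le_max_right _ _)).trans hM) y
  have hFax := hFa x (((le_max_left _ _).trans (le_max_right _ _)).trans hM)
  have hG : GeoOK (geo9Y x) := ⟨geo9Y_dist_triangle x, geo9Y_dist_comm x, geo9K_dist_nonneg x.toKIdx, geo9Y_len_pos x⟩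
  have hN : 0 < N := Nat.pos_of_ne_zero (NeZero.ne N)
  have hcR : 0 < cR39 (trBasis N) := cR39_trBasis_pos hN
  have hθ : 0 ≤ (geo9Y x).M * α₀ := mul_nonneg (hM₀.trans hM0) hα.le
  have hcf := abs_cf_eq_nKT x.toKIdx x.hcfk
  have hNr : ∀ (y : IBondY x.toKIdx) (z : SiteY x.toKIdx), B9MultiscaleSmoothPartitionY.NearY x.toKIdx y z → (geo9K x.toKIdx).dist y (sIK x.toKIdx (bI x) z) ≤ rNear d ℓ + 1 :=
    fun y z h => dist_sIK_le_of_nearY x.toKIdx (hβ1 x) h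
  have hLx : (geo9Y x).L ≤ (((ℓ + 1 : ℕ) : ℝ)) := (geo9Y_scalars x).2.1
  have hL0 : 0 ≤ (geo9Y x).L := le_trans zero_le_one hFax.one_le_L
  have hi : 0 ≤ (cR39 (trBasis N))⁻¹ := inv_nonneg.2 hcR.le
  have hws' : 0 ≤ (wX s44)⁻¹ := inv_nonneg.2 hwX44.le
  -- the pinned member facts in R5's letters
  have h31' : Thm31GpMaj (g := geo9Y x) (blkSK x.toKIdx (sIK x.toKIdx (bI x))) (blkBK x.toKIdx (bI x))
      (GcoS x.toKIdx (trBasis N) (bg9YR (Matrix (Fin N) (Fin N) ℂ) (specialUnitaryUnits (Fin N)) R₁ R₂ x) (fun U => U) (GpY x.toKIdx (parT x.toKIdx)) U)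
      (DvcoKH x.toKIdx (trBasis N) (bg9YR (Matrix (Fin N) (Fin N) ℂ) (specialUnitaryUnits (Fin N)) R₁ R₂ x) (fun U => U) U) (DvscoKH x.toKIdx (trBasis N) (bg9YR (Matrix (Fin N) (Fin N) ℂ) (specialUnitaryUnits (Fin N)) R₁ R₂ x) (fun U => U) U) 1 (H x) B₀ δ₀ := by
    rw [← hGp x]; exact h31 x hM0 α₀ hα ha U hU
  have h49' : Proj349Maj (g := geo9Y x) (blkSK x.toKIdx (sIK x.toKIdx (bI x))) (blkBK x.toKIdx (bI x))
      (PcoK x.toKIdx (trBasis N) (bg9YR (Matrix (Fin N) (Fin N) ℂ) (specialUnitaryUnits (Fin N)) R₁ R₂ x) (fun U => U) (parT x.toKIdx) (GpY x.toKIdx (parT x.toKIdx)) U)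
      (DvcoKH x.toKIdx (trBasis N) (bg9YR (Matrix (Fin N) (Fin N) ℂ) (specialUnitaryUnits (Fin N)) R₁ R₂ x) (fun U => U) U) (DvscoKH x.toKIdx (trBasis N) (bg9YR (Matrix (Fin N) (Fin N) ℂ) (specialUnitaryUnits (Fin N)) R₁ R₂ x) (fun U => U) U) 1 (H x) CP δP := by
    rw [← hGp x, ← hparS x]; exact h49 x hM0 α₀ hα ha U hU
  have hD2x := hD2 x hM0 α₀ hα ha U hU hU'
  have h44x := h44G x hM0 α₀ hα ha U hU hU'
  have h43x := h43 x hM0 α₀ hα ha U hU hU'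
  have htax := hta x hM0 α₀ hα ha U hU hU'
  have htbx := htbH x hM0 α₀ hα ha U hU hU'
  rw [hDvco12 x U, hDvsco12 x U] at h44x
  rw [hblk12 x] at hD2x h44x h43x htax htbx
  rw [hbH13 x U] at h43x htbx
  have hsplit := tpi_t2_splitL_of_pins x.toKIdx (trBasis N) (bg9YR (Matrix (Fin N) (Fin N) ℂ) (specialUnitaryUnits (Fin N)) R₁ R₂ x) (fun U => U) (parT x.toKIdx)
    (GpPhysY x.toKIdx (parT x.toKIdx)) (Δ2 x) (𝔬12 x) U (hTpico12 x U) (hT2co12 x U) (hDvco12 x U)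
  have hθ₂' : 0 ≤ θ₂ * ((geo9Y x).M * α₀) := mul_nonneg hθ₂ hθ
  have htA' : 0 ≤ tA * ((geo9Y x).M * α₀) := mul_nonneg htA hθ
  -- R5 §3: the raw letters `ta`, `tbH` on the state source (rate δS, δS + σ ≤ δT)
  have hTa := hasMaj_state_of_raw_two x.toKIdx (trBasis N) (taxiB x.toKIdx (bg9YR (Matrix (Fin N) (Fin N) ℂ) (specialUnitaryUnits (Fin N)) R₁ R₂ x) (fun U => U) U) (R₀ := (1 : ℝ)) (H₀ := H x)
    wX hwX₀ hwX₁ hG hFax hrowx hs440 hs441 hwX44 (hlev x) (hbI0 x) hNr hcf htA' hδS hbudT hτ' htax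
  have hTb := hasMaj_state_of_raw_two x.toKIdx (trBasis N) (taxiB x.toKIdx (bg9YR (Matrix (Fin N) (Fin N) ℂ) (specialUnitaryUnits (Fin N)) R₁ R₂ x) (fun U => U) U) (R₀ := (1 : ℝ)) (H₀ := H x)
    wX hwX₀ hwX₁ hG hFax hrowx hs440 hs441 hwX44 (hlev x) (hbI0 x) hNr hcf htA' hδS hbudT hτ' htbx
  -- R5 §1: `ta₂` at the state from h44G; R5 §2: `tb₂H` into bH13 from h43
  have hr44' : r + 1 / 2 * (2 * τ) ≤ δ44 := by linarith
  have hbud' : δS + 3 * σ + 3 * (1 / 2 * (2 * τ)) ≤ r := by linarith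
  have hTa2 := ta2S_pins_print_of_h44G x.toKIdx (trBasis N) (bg9YR (Matrix (Fin N) (Fin N) ℂ) (specialUnitaryUnits (Fin N)) R₁ R₂ x) (fun U => U) (parT x.toKIdx) (Δ2 x)
    (taxiB x.toKIdx (bg9YR (Matrix (Fin N) (Fin N) ℂ) (specialUnitaryUnits (Fin N)) R₁ R₂ x) (fun U => U) U) (R₀ := (1 : ℝ)) (H₀ := H x) wX hwX₀ hwX₁ hG hFax hrowx hcR hs440 hs441 hwX44
    (hlev x) (hbI0 x) hNr hcf h31' h49' hD2x h44x hB₀ hCP hθ₂' hB44 hc0 hσ.le hτ' hr hr₀ hrP hr₂ hr44' hδS hbud'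
  have hTb2 := tb₂HS_pins_print_of_h43 x.toKIdx (trBasis N) (bg9YR (Matrix (Fin N) (Fin N) ℂ) (specialUnitaryUnits (Fin N)) R₁ R₂ x) (fun U => U) (parT x.toKIdx) (Δ2 x)
    (taxiB x.toKIdx (bg9YR (Matrix (Fin N) (Fin N) ℂ) (specialUnitaryUnits (Fin N)) R₁ R₂ x) (fun U => U) U) (R₀ := (1 : ℝ)) (H₀ := H x) wX hwX₀ hwX₁ w13 hw13₀ hw13₁ hG hFax hrowx hcR
    hs440 hs441 hwX44 (hβ1 x) (hlev x) (hbI0 x) hNr hcf (links_le_one hGR x hU) h31' h49' hD2x h44x h43x hB₀ hCP hθ₂' hB44 hB43 hc0 hσ.le hτ' hr hr₀ hrP hr₂ hr44' hδS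
    hbud' hbud43
  rw [hτe] at hTa hTb hTa2 hTb2
  rw [← hblk12 x] at hTa hTa2
  rw [← hbH13 x U] at hTb hTb2
  rw [hbXH x U]
  have hL0K : 0 ≤ (geo9K x.toKIdx).L := hL0
  have hLxK : (geo9K x.toKIdx).L ≤ (((ℓ + 1 : ℕ) : ℝ)) := hLx
  have hLc0 : (0 : ℝ) ≤ (((ℓ + 1 : ℕ) : ℝ)) := Nat.cast_nonneg _
  have hK2 := (ta2_expr_le (r := r) (τ := τ) (rN := rNear d ℓ + 1) hL0K hLxK hws' hi hB44 hB₀ hCP hc0 hθ₂').trans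
    (le_of_eq (show _ = θ₂ * ((((ℓ + 1 : ℕ) : ℝ)) ^ 2 * (((wX s44)⁻¹ * ((((ℓ + 1 : ℕ) : ℝ)) * Real.exp ((r + τ) * (rNear d ℓ + 1))) * (((ℓ + 1 : ℕ) : ℝ))) + (cR39 (trBasis N))⁻¹ * ((wX s44)⁻¹ * B44 * (((ℓ + 1 : ℕ) : ℝ))) + (cR39 (trBasis N))⁻¹ * (B₀ * (((ℓ + 1 : ℕ) : ℝ)) * (CP * (((ℓ + 1 : ℕ) : ℝ)) ^ 2) * (rowConst261 (@geo9Y d ℓ hd hL b₀ b₁ Mstar) σ) * ((wX s44)⁻¹ * ((((ℓ + 1 : ℕ) : ℝ)) * Real.exp ((r + τ) * (rNear d ℓ + 1))) * (((ℓ + 1 : ℕ) : ℝ))) * (rowConst261 (@geo9Y d ℓ hd hL b₀ b₁ Mstar) σ))) * (rowConst261 (@geo9Y d ℓ hd hL b₀ b₁ Mstar) σ)) * ((geo9Y x).M * α₀) by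
      ring))
  have hK0 := ta2_expr_nonneg (L := (geo9K x.toKIdx).L) (r := r) (τ := τ) (rN := rNear d ℓ + 1) hL0K hLc0 hws' hi hB44 hB₀ hCP hc0 hθ₂'
  have hK3 := (tb2_expr_le (d := d) (ℓ := ℓ) (trBasis N) (δ := δS) hK0 hK2 hL0K hLxK hi hB43 hB₀ hCP hc0).trans (mul_le_mul_of_nonneg_right htS₃ hθ)
  have hK1 : tA * ((geo9Y x).M * α₀) * ((wX s44)⁻¹ * ((((ℓ + 1 : ℕ) : ℝ)) * Real.exp ((δS + τ) * (rNear d ℓ + 1))) * (geo9K x.toKIdx).L) *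
      rowConst261 (@geo9Y d ℓ hd hL b₀ b₁ Mstar) σ ≤ tS * ((geo9Y x).M * α₀) :=
    calc _ ≤ tA * ((geo9Y x).M * α₀) * ((wX s44)⁻¹ * ((((ℓ + 1 : ℕ) : ℝ)) * Real.exp ((δS + τ) * (rNear d ℓ + 1))) * (((ℓ + 1 : ℕ) : ℝ))) * rowConst261 (@geo9Y d ℓ hd hL b₀ b₁ Mstar) σ := by gcongr
      _ = tA * ((wX s44)⁻¹ * ((((ℓ + 1 : ℕ) : ℝ)) * Real.exp ((δS + τ) * (rNear d ℓ + 1))) * (((ℓ + 1 : ℕ) : ℝ))) * rowConst261 (@geo9Y d ℓ hd hL b₀ b₁ Mstar) σ * ((geo9Y x).M * α₀) := by ring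
      _ ≤ tS * ((geo9Y x).M * α₀) := mul_le_mul_of_nonneg_right htS₁ hθ
  exact
    { split := hsplit.1
      split₂ := hsplit.2
      ta := hTa.mono fun a b => mul_le_mul_of_nonneg_right hK1 (Real.exp_nonneg _)
      ta₂ := hTa2.mono fun a b => mul_le_mul_of_nonneg_right (hK2.trans (mul_le_mul_of_nonneg_right htS₂ hθ)) (Real.exp_nonneg _)
      tbH := hTb.mono fun a b => mul_le_mul_of_nonneg_right hK1 (Real.exp_nonneg _)
      tb₂H := hTb2.mono fun a b => mul_le_mul_of_nonneg_right hK3 (Real.exp_nonneg _) }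

end Summit.QuantumFields.YangMills.BalabanUVNodes.N06LettersSAtPinsPUPar
end
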